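import Summits.PneNP.PneNP.Theorems.PseudorandomTwinsAbove.Negative.RegularTests

/-!
# Route PhaseTwins, crux `PseudorandomTwinsAbove` (stmt-PneNP-2721) — negative side: escape and junk

Continuation of `Negative/RegularTests.lean` (crux stmt-PneNP-2721,
`Summit.PneNP.PneNP.Theses.PhaseTwins.PseudorandomTwinsAbove`; disprover's work file
`Summits/PneNP/PneNP/Cruxes/PseudorandomTwinsAbove/Disproof.lean`, cycle 2).

* `finset_mass_tendsto_zero`, `shortStrings_mass_tendsto_zero` (clauses (i)+(ii)): every finite
  set of strings, in particular `{x : |x| ≤ L}`, has vanishing mass under BOTH ensembles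
  (length escape — the first step of glue 2723): singleton tests merge the atoms, the key estimate
  `mass_finset_le_of_disjoint` does the rest;
* `hardcoreCount_junk`, `junk_mass_tendsto_zero`: every string `1 0 w` decodes to the empty graph
  and has hard-core count `N = 1`, so the NO-event `{0 < N ≤ t n}` of clause (ii) contains the
  whole cylinder `10{0,1}*`; positivity `0 < N` does not force `D₁` onto genuine graph codes, but
  indistinguishability from `D₀` does (`D₁(10{0,1}*) → 0`, a 4-state DFA test).
-/

namespace Summit.PneNP.PneNP.Theorems.PseudorandomTwinsAbove.Negative

open Literature.Computability.Complexity Literature.Computability.MetaComplexity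
open Filter Topology
open scoped ENNReal

noncomputable section

/-! ## Consequences of clauses (i)+(ii): finite sets escape -/

/-- LENGTH / ATOM ESCAPE. Under clause (i) and the abstract clause (ii) (`D₀ n (U n) → 1`,
`D₁ n (V n) → 1`, `U n ∩ V n = ∅`) every finite set of strings has vanishing mass under BOTH
ensembles: singleton tests merge the point masses (`finite_merge`), and the key estimate
`mass_finset_le_of_disjoint` bounds `D₀ n (Φ)` by the pointwise discrepancy on `Φ` plus the
mass defects of `U n`, `V n`. [this work] -/
theorem finset_mass_tendsto_zero (D₀ D₁ : Ensemble)
    (hind : ∀ A : RandAlg (List Bool) Bool,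
      A.IsPolyTime (id : List Bool → List Bool) Computability.encodeBool →
      Tendsto (fun n : ℕ => |(∑' x : List Bool, ((D₀ n) x).toReal * A.pr id x {b | b = true}) -
        (∑' x : List Bool, ((D₁ n) x).toReal * A.pr id x {b | b = true})|) atTop (𝓝 0))
    (U V : ℕ → Set (List Bool)) (hUV : ∀ n, Disjoint (U n) (V n))
    (h₀ : Tendsto (fun n => D₀.prob n (U n)) atTop (𝓝 1))
    (h₁ : Tendsto (fun n => D₁.prob n (V n)) atTop (𝓝 1)) (Φ : Finset (List Bool)) :
    Tendsto (fun n => D₀.prob n ↑Φ) atTop (𝓝 0) ∧ Tendsto (fun n => D₁.prob n ↑Φ) atTop (𝓝 0) := by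
  -- pointwise discrepancy on Φ tends to 0 (singleton tests)
  have hd : Tendsto (fun n => ∑ x ∈ Φ, |(PMF.toOuterMeasure (D₀ n) {x}).toReal -
      (PMF.toOuterMeasure (D₁ n) {x}).toReal|) atTop (𝓝 0) := by
    have h' := tendsto_finsetSum Φ
      (fun x (_ : x ∈ Φ) => finite_merge D₀ D₁ hind (Set.finite_singleton x))
    simpa [Ensemble.prob] using h'
  have hd' : Tendsto (fun n => ∑ x ∈ Φ, |(PMF.toOuterMeasure (D₁ n) {x}).toReal -
      (PMF.toOuterMeasure (D₀ n) {x}).toReal|) atTop (𝓝 0) := by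
    refine hd.congr fun n => Finset.sum_congr rfl fun x _ => abs_sub_comm _ _
  have hU : Tendsto (fun n => 1 - D₀.prob n (U n)) atTop (𝓝 0) := by
    simpa using (tendsto_const_nhds (x := (1 : ℝ))).sub h₀
  have hV : Tendsto (fun n => 1 - D₁.prob n (V n)) atTop (𝓝 0) := by
    simpa using (tendsto_const_nhds (x := (1 : ℝ))).sub h₁
  constructor
  · have hup : Tendsto (fun n => (∑ x ∈ Φ, |(PMF.toOuterMeasure (D₀ n) {x}).toReal -
        (PMF.toOuterMeasure (D₁ n) {x}).toReal|) + (1 - D₁.prob n (V n)) + (1 - D₀.prob n (U n)))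
        atTop (𝓝 0) := by
      simpa using (hd.add hV).add hU
    refine tendsto_of_tendsto_of_tendsto_of_le_of_le tendsto_const_nhds hup
      (fun n => Ensemble.prob_nonneg _ _ _) (fun n => ?_)
    exact mass_finset_le_of_disjoint (D₀ n) (D₁ n) (hUV n) Φ
  · have hup : Tendsto (fun n => (∑ x ∈ Φ, |(PMF.toOuterMeasure (D₁ n) {x}).toReal -
        (PMF.toOuterMeasure (D₀ n) {x}).toReal|) + (1 - D₀.prob n (U n)) + (1 - D₁.prob n (V n)))
        atTop (𝓝 0) := by
      simpa using (hd'.add hU).add hV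
    refine tendsto_of_tendsto_of_tendsto_of_le_of_le tendsto_const_nhds hup
      (fun n => Ensemble.prob_nonneg _ _ _) (fun n => ?_)
    exact mass_finset_le_of_disjoint (D₁ n) (D₀ n) (hUV n).symm Φ

/-- In particular short strings carry no mass: for every `L`, `Dᵢ n {x : |x| ≤ L} → 0` for both
ensembles (the length-escape lemma behind glue 2723). [this work] -/
theorem shortStrings_mass_tendsto_zero (D₀ D₁ : Ensemble)
    (hind : ∀ A : RandAlg (List Bool) Bool,
      A.IsPolyTime (id : List Bool → List Bool) Computability.encodeBool →
      Tendsto (fun n : ℕ => |(∑' x : List Bool, ((D₀ n) x).toReal * A.pr id x {b | b = true}) -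
        (∑' x : List Bool, ((D₁ n) x).toReal * A.pr id x {b | b = true})|) atTop (𝓝 0))
    (U V : ℕ → Set (List Bool)) (hUV : ∀ n, Disjoint (U n) (V n))
    (h₀ : Tendsto (fun n => D₀.prob n (U n)) atTop (𝓝 1))
    (h₁ : Tendsto (fun n => D₁.prob n (V n)) atTop (𝓝 1)) (L : ℕ) :
    Tendsto (fun n => D₀.prob n {x | x.length ≤ L}) atTop (𝓝 0) ∧
      Tendsto (fun n => D₁.prob n {x | x.length ≤ L}) atTop (𝓝 0) := by
  have hfin := List.finite_length_le Bool L
  have h := finset_mass_tendsto_zero D₀ D₁ hind U V hUV h₀ h₁ hfin.toFinset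
  simpa only [Set.Finite.coe_toFinset] using h

/-! ## The junk cylinder `10{0,1}*`: hard-core count `1`, yet negligible for `D₁` -/

open scoped Classical in
/-- EVERY STRING `1 0 w` HAS HARD-CORE COUNT `1`: `boolUnpair (1 0 w) = ([], [])`, vertex count
`decodeNat [] = 0`, payload `[]` of the right length `0 · 0`, so it decodes to the empty graph on
`Fin 0` (max degree `0 ≤ Δ`), whose only independent set is `∅`. Hence the NO-event
`{0 < N ≤ t n}` of clause (ii) contains the cylinder `10{0,1}*` as soon as `t n ≥ 1`: the
positivity conjunct excludes the `N = 0` junk (`decode_junk`) but not this one. [this work] -/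
theorem hardcoreCount_junk (Δ p q : ℕ) (w : List Bool) :
    (match Literature.Computability.Complexity.encodingGraph.decode (true :: false :: w) with
      | none => 0
      | some G => if G.2.maxDegree ≤ Δ then ∑ I : Finset (Fin G.1),
          (if G.2.IsIndepSet (↑I : Set (Fin G.1)) then p ^ I.card * q ^ (G.1 - I.card) else 0)
        else 0) = 1 := by
  obtain ⟨G, hG⟩ : ∃ G : SimpleGraph (Fin 0),
      Literature.Computability.Complexity.encodingGraph.decode (true :: false :: w) = some ⟨0, G⟩ :=
    ⟨_, rfl⟩
  simp only [hG]
  have hdeg : G.maxDegree ≤ Δ := SimpleGraph.maxDegree_le_of_forall_degree_le _ _ fun v => v.elim0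
  rw [if_pos hdeg, Fintype.sum_subsingleton _ (∅ : Finset (Fin 0))]
  simp

/-- The cylinder `10{0,1}*` is recognised by a 4-state DFA. [folklore] -/
theorem exists_dfa_junkCylinder :
    ∃ M : DFA Bool (Fin 4), ∀ x, M.eval x ∈ M.accept ↔ ∃ w, x = true :: false :: w := by
  let M : DFA Bool (Fin 4) :=
    { step := fun s a => if s = 0 then (if a then 1 else 3) else if s = 1 then (if a then 3 else 2)
        else s
      start := 0
      accept := {s | s = 2} }
  have hstay : ∀ (w : List Bool) (s : Fin 4), s ≠ 0 → s ≠ 1 → M.evalFrom s w = s := by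
    intro w
    induction w with
    | nil => intro s _ _; rfl
    | cons a w ih =>
      intro s h0 h1
      rw [DFA.evalFrom_cons]
      have : M.step s a = s := by simp [M, h0, h1]
      rw [this]
      exact ih s h0 h1
  refine ⟨M, fun x => ?_⟩
  constructor
  · intro hx
    match x, hx with
    | [], hx => exact absurd hx (by simp [M, DFA.eval])
    | [a], hx =>
      exfalso
      cases a <;> simp [M, DFA.eval] at hx
    | a :: b :: w, hx =>
      cases a <;> cases b
      · exfalso
        have h3 : M.eval (false :: false :: w) = 3 := hstay w 3 (by decide) (by decide)
        rw [h3] at hx; exact absurd hx (by simp [M])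
      · exfalso
        have h3 : M.eval (false :: true :: w) = 3 := hstay w 3 (by decide) (by decide)
        rw [h3] at hx; exact absurd hx (by simp [M])
      · exact ⟨w, rfl⟩
      · exfalso
        have h3 : M.eval (true :: true :: w) = 3 := hstay w 3 (by decide) (by decide)
        rw [h3] at hx; exact absurd hx (by simp [M])
  · rintro ⟨w, rfl⟩
    have h2 : M.eval (true :: false :: w) = 2 := hstay w 2 (by decide) (by decide)
    rw [h2]
    simp [M]

open scoped Classical in
/-- THE NO-SAMPLER CANNOT HIDE IN THE JUNK. For every witness-shaped triple with the crux's
hard-core count `N`: although `10{0,1}* ⊆ {0 < N ≤ t n}` eventually (`hardcoreCount_junk`; `t n ≥ 1`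
eventually because `{0 < N ≤ 0} = ∅`), the cylinder is disjoint from the YES-event
`{8 t n ≤ N}`, so `D₀ n (10{0,1}*) → 0`, and the 4-state DFA test (`dfa_merge`) transfers this to
`D₁`: `D₁ n (10{0,1}*) → 0`. Positivity alone does not force `D₁` onto genuine graph codes;
indistinguishability from `D₀` does. [this work] -/
theorem junk_mass_tendsto_zero (Δ p q : ℕ) (D₀ D₁ : Ensemble) (t : ℕ → ℕ)
    (hind : ∀ A : RandAlg (List Bool) Bool,
      A.IsPolyTime (id : List Bool → List Bool) Computability.encodeBool →
      Tendsto (fun n : ℕ => |(∑' x : List Bool, ((D₀ n) x).toReal * A.pr id x {b | b = true}) -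
        (∑' x : List Bool, ((D₁ n) x).toReal * A.pr id x {b | b = true})|) atTop (𝓝 0))
    (h₀ : Tendsto (fun n : ℕ => D₀.prob n {x | 8 * t n ≤ (match
        Literature.Computability.Complexity.encodingGraph.decode x with
        | none => 0
        | some G => if G.2.maxDegree ≤ Δ then ∑ I : Finset (Fin G.1),
            (if G.2.IsIndepSet (↑I : Set (Fin G.1)) then p ^ I.card * q ^ (G.1 - I.card) else 0)
          else 0)}) atTop (𝓝 1))
    (h₁ : Tendsto (fun n : ℕ => D₁.prob n {x | 0 < (match
        Literature.Computability.Complexity.encodingGraph.decode x with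
        | none => 0
        | some G => if G.2.maxDegree ≤ Δ then ∑ I : Finset (Fin G.1),
            (if G.2.IsIndepSet (↑I : Set (Fin G.1)) then p ^ I.card * q ^ (G.1 - I.card) else 0)
          else 0) ∧ (match Literature.Computability.Complexity.encodingGraph.decode x with
        | none => 0
        | some G => if G.2.maxDegree ≤ Δ then ∑ I : Finset (Fin G.1),
            (if G.2.IsIndepSet (↑I : Set (Fin G.1)) then p ^ I.card * q ^ (G.1 - I.card) else 0)
          else 0) ≤ t n}) atTop (𝓝 1)) :
    Tendsto (fun n => D₀.prob n {x | ∃ w, x = true :: false :: w}) atTop (𝓝 0) ∧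
      Tendsto (fun n => D₁.prob n {x | ∃ w, x = true :: false :: w}) atTop (𝓝 0) := by
  -- abbreviate the count
  set N : List Bool → ℕ := fun x => (match
        Literature.Computability.Complexity.encodingGraph.decode x with
        | none => 0
        | some G => if G.2.maxDegree ≤ Δ then ∑ I : Finset (Fin G.1),
            (if G.2.IsIndepSet (↑I : Set (Fin G.1)) then p ^ I.card * q ^ (G.1 - I.card) else 0)
          else 0) with hN
  have hjunk : ∀ w, N (true :: false :: w) = 1 := fun w => by
    simp only [hN]; exact hardcoreCount_junk Δ p q w
  -- eventually `t n ≥ 1`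
  have ht : ∀ᶠ n in atTop, 0 < t n := by
    have e := h₁.eventually_const_lt (show (1 / 2 : ℝ) < 1 by norm_num)
    refine e.mono fun n hn => ?_
    by_contra h0
    have ht0 : t n = 0 := by omega
    have hempty : {x | 0 < N x ∧ N x ≤ t n} = ∅ := by
      ext x; simp only [Set.mem_setOf_eq, Set.mem_empty_iff_false, iff_false]; omega
    have : D₁.prob n {x | 0 < N x ∧ N x ≤ t n} = 0 := by
      rw [hempty]; simp [Ensemble.prob]
    change (1 / 2 : ℝ) < D₁.prob n {x | 0 < N x ∧ N x ≤ t n} at hn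
    linarith
  -- the cylinder is eventually disjoint from the YES-event, so its D₀-mass vanishes
  set J : Set (List Bool) := {x | ∃ w, x = true :: false :: w} with hJ
  have hJU : ∀ᶠ n in atTop, D₀.prob n J ≤ 1 - D₀.prob n {x | 8 * t n ≤ N x} := by
    refine ht.mono fun n hn => ?_
    have hsub : J ⊆ {x | 8 * t n ≤ N x}ᶜ := by
      rintro x ⟨w, rfl⟩ (hx : 8 * t n ≤ N (true :: false :: w))
      rw [hjunk] at hx
      omega
    have h' := mass_mono (D₀ n) hsub
    have hc := mass_add_compl (D₀ n) {x | 8 * t n ≤ N x}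
    change (PMF.toOuterMeasure (D₀ n) J).toReal ≤ 1 - (PMF.toOuterMeasure (D₀ n) _).toReal
    linarith
  have hD₀ : Tendsto (fun n => D₀.prob n J) atTop (𝓝 0) := by
    have hup : Tendsto (fun n => 1 - D₀.prob n {x | 8 * t n ≤ N x}) atTop (𝓝 0) := by
      simpa using (tendsto_const_nhds (x := (1 : ℝ))).sub h₀
    refine tendsto_of_tendsto_of_tendsto_of_le_of_le' tendsto_const_nhds hup
      (Eventually.of_forall fun n => Ensemble.prob_nonneg _ _ _) hJU
  -- transfer to D₁ by the DFA test
  obtain ⟨M, hM⟩ := exists_dfa_junkCylinder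
  have hset : {x | M.eval x ∈ M.accept} = J := Set.ext hM
  have hmerge := dfa_merge D₀ D₁ hind M
  rw [hset] at hmerge
  refine ⟨hD₀, ?_⟩
  have hsum : Tendsto (fun n => |D₀.prob n J - D₁.prob n J| + D₀.prob n J) atTop (𝓝 0) := by
    simpa using hmerge.add hD₀
  refine tendsto_of_tendsto_of_tendsto_of_le_of_le tendsto_const_nhds hsum
    (fun n => Ensemble.prob_nonneg _ _ _) (fun n => ?_)
  have := neg_abs_le (D₀.prob n J - D₁.prob n J)
  simp only at this ⊢
  linarith [abs_sub_comm (D₀.prob n J) (D₁.prob n J), le_abs_self (D₁.prob n J - D₀.prob n J)]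

end

end Summit.PneNP.PneNP.Theorems.PseudorandomTwinsAbove.Negative
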